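import Mathlib

/-!
# Crux `DigitPolyUniformity` (stmt-QuantumAdvantage-1392), line `Sketch` (LAR composition):
# the functional equation `λ(3m) = −λ(m)` alone has a low-degree digital near-solution

Calibration stub V5 of line Sketch/LAR of crux stmt-QuantumAdvantage-1392
(`Summit.QuantumAdvantage.QuantumAdvantage.Theses.MobiusLadder.DigitPolyUniformity`). The Liouville
function satisfies `λ(3m) = −λ(m)`; this file shows that this single functional equation is mimicked
EXACTLY, off the `2^{−d}` fraction of inputs divisible by `2^d`, by an `𝔽₂`-polynomial in the binary
digits of total degree `≤ d + 1` (`exists_lowDegree_mulThree_flip`): for `d + 2 ≤ n` there is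
`P ∈ 𝔽₂[x_0, …, x_{n−1}]`, `deg P ≤ d + 1`, with `P(bits 3m) ≠ P(bits m)` for every `m ≥ 1` with
`2^d ∤ m`.

Witness: `P = Σ_{w<d} (Π_{i<w} (1 − x_i)) x_w x_{w+1}`. Writing `m = 2^v m'` with `m'` odd (`v < d` as
`2^d ∤ m`), exactly the summand `w = v` survives at the digits of `m` and `P(bits m) = bit_{v+1}(m) =
bit_1(m') = [m' ≡ 3 (mod 4)]` (the character `χ₋₄` of the odd part); since `3m = 2^v (3m')` with `3m'`
odd and `3m' ≡ −m' (mod 4)`, `P(bits 3m) = bit_1(3m') ≠ bit_1(m')`.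

Design: the variables are indexed by `ℕ` through an arbitrary map `f : ℕ → σ` (in the theorem,
`j ↦ min j (n − 1) : ℕ → Fin n`, the identity on the indices `≤ d < n − 1` actually used), which keeps
all index arithmetic in `ℕ`. Pure finite sums and bit arithmetic; no named facts; Mathlib only.
-/

namespace Summit.QuantumAdvantage.DigitPolyUniformity.SketchLAR

open Filter Finset

namespace MulThreeFlip

/-- **Degree of the witness.** For any index map `f : ℕ → σ`, the polynomial
`Σ_{w<d} (Π_{i<w} (1 − X_{f i})) X_{f w} X_{f (w+1)}` has total degree `≤ d + 1` (the `w`-th summand has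
degree `≤ w + 2 ≤ d + 1`). [folklore] -/
theorem totalDegree_witness_le {σ R : Type*} [CommRing R] [Nontrivial R] (f : ℕ → σ) (d : ℕ) :
    (∑ w ∈ range d, (∏ i ∈ range w, (1 - MvPolynomial.X (f i))) * MvPolynomial.X (f w) *
        MvPolynomial.X (f (w + 1)) : MvPolynomial σ R).totalDegree ≤ d + 1 := by
  refine MvPolynomial.totalDegree_finsetSum_le fun w hw => ?_
  rw [mem_range] at hw
  have hprod : (∏ i ∈ range w, (1 - MvPolynomial.X (f i)) : MvPolynomial σ R).totalDegree ≤ w := by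
    refine (MvPolynomial.totalDegree_finsetProd _ _).trans ?_
    calc ∑ i ∈ range w, (1 - MvPolynomial.X (f i) : MvPolynomial σ R).totalDegree
        ≤ ∑ _i ∈ range w, 1 :=
          Finset.sum_le_sum fun i _ => (MvPolynomial.totalDegree_sub _ _).trans
            (max_le (MvPolynomial.totalDegree_one.trans_le (Nat.zero_le 1))
              (MvPolynomial.totalDegree_X _).le)
      _ = w := by simp
  have h1 := MvPolynomial.totalDegree_mul
    ((∏ i ∈ range w, (1 - MvPolynomial.X (f i))) * MvPolynomial.X (f w))
    (MvPolynomial.X (f (w + 1)) : MvPolynomial σ R)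
  have h2 := MvPolynomial.totalDegree_mul
    (∏ i ∈ range w, (1 - MvPolynomial.X (f i))) (MvPolynomial.X (f w) : MvPolynomial σ R)
  rw [MvPolynomial.totalDegree_X] at h1 h2
  omega

/-- **Evaluation of the witness.** If the values `g (f j)` vanish for `j < v` and `g (f v) = 1`
(`v < d`), then `Σ_{w<d} (Π_{i<w} (1 − X_{f i})) X_{f w} X_{f (w+1)}` evaluates at `g` to `g (f (v+1))`:
the summands `w < v` die by the factor `X_{f w}`, the summands `w > v` by the factor `1 − X_{f v}`, and
the summand `w = v` is `1 · 1 · g (f (v+1))`. [folklore] -/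
theorem eval_witness {σ R : Type*} [CommRing R] (f : ℕ → σ) (g : σ → R) {d v : ℕ} (hv : v < d)
    (hlow : ∀ j < v, g (f j) = 0) (hone : g (f v) = 1) :
    MvPolynomial.eval g (∑ w ∈ range d, (∏ i ∈ range w, (1 - MvPolynomial.X (f i))) *
        MvPolynomial.X (f w) * MvPolynomial.X (f (w + 1))) = g (f (v + 1)) := by
  rw [map_sum, Finset.sum_eq_single_of_mem v (mem_range.mpr hv)]
  · rw [map_mul, map_mul, map_prod, MvPolynomial.eval_X, MvPolynomial.eval_X, hone, mul_one,
      Finset.prod_eq_one, one_mul]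
    intro i hi
    rw [map_sub, map_one, MvPolynomial.eval_X, hlow i (mem_range.mp hi), sub_zero]
  · intro w _ hne
    rcases hne.lt_or_gt with h | h
    · rw [map_mul, map_mul, MvPolynomial.eval_X, hlow w h, mul_zero, zero_mul]
    · rw [map_mul, map_mul, map_prod, Finset.prod_eq_zero (mem_range.mpr h), zero_mul, zero_mul]
      rw [map_sub, map_one, MvPolynomial.eval_X, hone, sub_self]

/-- Bits below the `2`-adic valuation vanish: `bit_j(2^v k) = 0` for `j < v`. [folklore] -/
theorem testBit_two_pow_mul_of_lt (k : ℕ) {v j : ℕ} (hj : j < v) :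
    Nat.testBit (2 ^ v * k) j = false := by
  simp [Nat.testBit_two_pow_mul, not_le.mpr hj]

/-- The bit at the `2`-adic valuation is set: `bit_v(2^v k) = 1` for odd `k`. [folklore] -/
theorem testBit_two_pow_mul_self {v k : ℕ} (hk : Odd k) : Nat.testBit (2 ^ v * k) v = true := by
  rw [Nat.odd_iff] at hk
  simp [Nat.testBit_two_pow_mul, hk]

/-- The bit just above: `bit_{v+1}(2^v k) = bit_1(k)`. [folklore] -/
theorem testBit_two_pow_mul_succ (v k : ℕ) : Nat.testBit (2 ^ v * k) (v + 1) = Nat.testBit k 1 := by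
  simp [Nat.testBit_two_pow_mul]

/-- **`3 ≡ −1 (mod 4)` on bits.** For odd `k`, `bit_1(3k) ≠ bit_1(k)`: if `k ≡ 1 (mod 4)` then
`3k ≡ 3 (mod 4)`, and if `k ≡ 3 (mod 4)` then `3k ≡ 1 (mod 4)`. [folklore] -/
theorem testBit_one_three_mul_ne {k : ℕ} (hk : Odd k) : Nat.testBit (3 * k) 1 ≠ Nat.testBit k 1 := by
  simp only [Nat.testBit_eq_decide_div_mod_eq, pow_one]
  obtain h | h : k % 4 = 1 ∨ k % 4 = 3 := by
    obtain ⟨t, rfl⟩ := hk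
    omega
  · rw [show 3 * k / 2 % 2 = 1 by omega, show k / 2 % 2 = 0 by omega]
    decide
  · rw [show 3 * k / 2 % 2 = 0 by omega, show k / 2 % 2 = 1 by omega]
    decide

/-- Distinct bits give distinct elements of `𝔽₂` under `b ↦ [b]`. [folklore] -/
theorem ite_one_zero_ne {b c : Bool} (h : b ≠ c) :
    (if b then (1 : ZMod 2) else 0) ≠ (if c then (1 : ZMod 2) else 0) := by
  revert h
  cases b <;> cases c <;> decide

/-- **The witness at the digits of `2^v k`, `k` odd, `v < d`.** For an index map `f : ℕ → Fin n`
that is the identity on indices `≤ d`, the witness `Σ_{w<d} (Π_{i<w} (1 − X_{f i})) X_{f w} X_{f (w+1)}`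
evaluates at the digit vector of `2^v k` to `[bit_1(k)]`. [folklore] -/
theorem eval_witness_bits {n d v k : ℕ} (f : ℕ → Fin n) (hf : ∀ j ≤ d, ((f j : Fin n) : ℕ) = j)
    (hv : v < d) (hk : Odd k) :
    MvPolynomial.eval (fun i : Fin n => if Nat.testBit (2 ^ v * k) i then (1 : ZMod 2) else 0)
        (∑ w ∈ range d, (∏ i ∈ range w, (1 - MvPolynomial.X (f i))) * MvPolynomial.X (f w) *
          MvPolynomial.X (f (w + 1))) =
      if Nat.testBit k 1 then 1 else 0 := by
  rw [eval_witness f _ hv]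
  · show (if Nat.testBit (2 ^ v * k) (f (v + 1)) then (1 : ZMod 2) else 0) = _
    rw [hf _ (by omega), testBit_two_pow_mul_succ]
  · intro j hj
    show (if Nat.testBit (2 ^ v * k) (f j) then (1 : ZMod 2) else 0) = 0
    rw [hf _ (by omega), testBit_two_pow_mul_of_lt k hj]
    exact if_neg Bool.false_ne_true
  · show (if Nat.testBit (2 ^ v * k) (f v) then (1 : ZMod 2) else 0) = 1
    rw [hf _ hv.le, testBit_two_pow_mul_self hk]
    exact if_pos rfl

end MulThreeFlip

open MulThreeFlip in
/-- **Stub V5 (single-prime functional equations have low-degree near-solutions: the `×3` case).** For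
`d + 2 ≤ n` there is `P ∈ 𝔽₂[x_0, …, x_{n−1}]` of total degree `≤ d + 1` with `P(bits 3m) ≠ P(bits m)`
for EVERY `m ≥ 1` not divisible by `2^d` — so `[P = 1]` transforms under `m ↦ 3m` exactly as `[λ = −1]`
does (`λ(3m) = −λ(m)`) off a `2^{−d}` fraction of inputs. Witness:
`P = Σ_{w<d} (Π_{i<w} (1 − x_i)) x_w x_{w+1}`, i.e. `P(bits m) = bit_{v₂(m)+1}(m) = [odd part of m ≡ 3 (mod 4)]`,
the character `χ₋₄` of the odd part, and `3 ≡ −1 (mod 4)` (`MulThreeFlip.eval_witness_bits`,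
`MulThreeFlip.testBit_one_three_mul_ne`). Together with the `2`-adic shell functions and the Benford
chirps this shows that no proof of even the weak inapproximability the `AC⁰[⊕]` rung needs can run on the
identities `λ(pm) = −λ(m)` at boundedly many primes alone (dossier
`Cruxes/DigitPolyUniformity/Lines/SketchLAR-c4-weak.md`). [folklore] -/
theorem exists_lowDegree_mulThree_flip (n d : ℕ) (hd : d + 2 ≤ n) :
    ∃ P : MvPolynomial (Fin n) (ZMod 2), P.totalDegree ≤ d + 1 ∧
      ∀ m : ℕ, 0 < m → ¬ 2 ^ d ∣ m →
        MvPolynomial.eval (fun i : Fin n => if Nat.testBit (3 * m) i then (1 : ZMod 2) else 0) P ≠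
          MvPolynomial.eval (fun i : Fin n => if Nat.testBit m i then (1 : ZMod 2) else 0) P := by
  -- `ℕ`-indexed variables: index `j ↦ min j (n - 1)`; only indices `≤ d < n - 1` ever occur.
  let f : ℕ → Fin n := fun j => ⟨min j (n - 1), by omega⟩
  have hf : ∀ j ≤ d, ((f j : Fin n) : ℕ) = j := fun j hj => by
    show min j (n - 1) = j
    omega
  refine ⟨∑ w ∈ range d, (∏ i ∈ range w, (1 - MvPolynomial.X (f i))) * MvPolynomial.X (f w) *
      MvPolynomial.X (f (w + 1)), totalDegree_witness_le f d, fun m hm hdm => ?_⟩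
  obtain ⟨v, k, hk, rfl⟩ := Nat.exists_eq_two_pow_mul_odd hm.ne'
  have hv : v < d := by
    by_contra h
    exact hdm ((pow_dvd_pow 2 (not_lt.mp h)).trans (dvd_mul_right _ _))
  have hk3 : Odd (3 * k) := by
    obtain ⟨t, rfl⟩ := hk
    exact ⟨3 * t + 1, by ring⟩
  rw [show 3 * (2 ^ v * k) = 2 ^ v * (3 * k) by ring, eval_witness_bits f hf hv hk3,
    eval_witness_bits f hf hv hk]
  exact ite_one_zero_ne (testBit_one_three_mul_ne hk)

end Summit.QuantumAdvantage.DigitPolyUniformity.SketchLAR
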